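import Summits.BirchSwinnertonDyer.BirchSwinnertonDyer.Theorems.ErratumRoadFiveIMCDivRoadFFSigmaDataBNoDefect
import Literature.NumberTheory.EllipticCurves.JetchevSkinnerWan2017.SigmaLocalCharIdealProofs
import Literature.NumberTheory.EllipticCurves.JetchevSkinnerWan2017.AnticyclotomicControlMultiplicative
import HarnessLib

/-!
# Route `ErratumRoadFive` (rung K2, `p ≥ 5`), Road FF: the `Σ`-DATA AT EVERY ERRATUM DATUM from the LOCAL fact
# `sigmaLocal_charIdeal_eulerFactor_mem_of_noTamagawaDefect` + Shapiro (SU14 Prop. 3.2.3) + control (JSW17 Thm. 3.3.1)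
# — WITHOUT the composite `prop332_…_of_noTamagawaDefect` (no surjectivity of localisation ∕ Poitou–Tate)

Cell `bsd-stepL` (run/shared/lean/pub/bsd-stepL/), seat `bsd-stepL-imc-p1` (prover g12, 2026-08-27); `--supports
stmt-BirchSwinnertonDyer-20427 --as helper`; Theses-free. The Road-FF shape `P2.RoadFF.SigmaDataAt W p κ 𝔭 γ Σ P_Σ`
(`Σ` finite ∧ `X^Σ_ac` torsion ∧ `P_Σ ≠ 0` ∧ `Ch_Λ(X^∅_ac)·(P_Σ) ⊆ Ch_Λ(X^Σ_ac)`) consumes of JSW17's `Σ`-change only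
its ONE-SIDED half, which needs no surjectivity of localisation: it is PROVED in
`Literature/…/JetchevSkinnerWan2017/SigmaLocalCharIdealProofs.lean`
(`isTorsion_XAc_and_charIdeal_empty_mul_le_of_sigmaLocal_of_prop323`) from (i) the LOCAL named fact
`JetchevSkinnerWan2017.sigmaLocal_charIdeal_eulerFactor_mem_of_noTamagawaDefect` (per place `w ∤ p`: `H¹(K_w, T⊗Λ^*)^∨`
f.g. `Λ`-torsion with `P_w ∈ Ch_Λ`; JSW17 proof of Thm. 6.1.6 local display ∕ Ski16 §2.3 ∕ GV00 Prop. 2.4 ∕ PW11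
L. 3.2 + Cas18 (2.7), Prop. 2.5), (ii) Shapiro `SkinnerUrban2014.prop323_XAc_equiv_XBigDecomp` (K2 item 20430) and
(iii) the torsion of `X^∅_ac`, here supplied at an erratum datum by JSW17 Thm. 3.3.1 (`thm331_anticyclotomicControl_mult`,
K2 item 19626). This file assembles the three at erratum data:

* §1 **`P2.RoadFF.isTorsion_XAc_empty_of_thm331_of_isErratumField`** — `X^∅_ac(E/K_∞)_v` is `Λ`-torsion at an
  erratum field, any degree-one slot `v ∋ p` (from `h331` + GZK + modularity; binders discharged as in
  `…SigmaDataBNoDefect.lean` §2).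
* §2 `P2.RoadFF.sigmaDataAt_of_sigmaLocal_of_prop323_of_thm331_of_isErratumField` (one erratum field, any slot) and
  **`P2.RoadFF.sigmaDataAtErratumDataB_of_sigmaLocal_of_prop323_of_thm331`** :
  `sigmaLocal_… → prop323_… → thm331_…_mult → GZK → modularity → P2.RoadFF.SigmaDataAtErratumDataB W p Σ(·) P_Σ(·)`
  (+ the A-slot twin `…sigmaDataAtErratumData_of_…`) — the `Σ`-stub of the registered skeleton of crux 20169 with the
  composite binder `h332 : prop332_charIdeal_XAc_sigma_change_of_noTamagawaDefect` (K2 item 20427) REPLACED by the local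
  atom + two binders the route already holds (20430, 19626). A planner DOWN-edit of 20427 to the local fact is thereby
  certified Theses-free.

HONEST FRAMING: theorems only; CONDITIONAL on the named PUBLISHED facts (the local fact, SU14 Prop. 3.2.3, JSW17
Thm. 3.3.1 at multiplicative `p`, Gross–Zagier–Kolyvagin, modularity); nothing is booked; BSD is proved for no pair; no
count moves (T7).

References: [JetchevSkinnerWan2017] §5.1, proof of Thm. 6.1.6, Thm. 3.3.1 with §3.5 (3.5.c); [Skinner2016PacificMC]
§2.3 (p. 180); [SkinnerUrban2014] Prop. 3.2.3; [GreenbergVatsal2000] Prop. 2.4; [PollackWeston2011] Lemma 3.2;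
[Castella2018] Def. 2.2, (2.7), Prop. 2.5, (3.1); [Castella2018Erratum] proof of Thm. 1.1 (p. 4); [Brink2007] Thm. 2.
-/

set_option autoImplicit false

noncomputable section

open scoped Classical

open WeierstrassCurve NumberField IsDedekindDomain Field PowerSeries
open Literature.NumberTheory.EllipticCurves Literature.NumberTheory.EllipticCurves.GreenbergSelmer
  Literature.NumberTheory.EllipticCurves.ModularForms Literature.NumberTheory.EllipticCurves.Rank1Residual
  Literature.NumberTheory.EllipticCurves.Rank1Residual.Typed Literature.NumberTheory.EllipticCurves.Castella2018
  Literature.NumberTheory.EllipticCurves.JetchevSkinnerWan2017 Literature.NumberTheory.GaloisRepresentations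
  Literature.NumberTheory.GaloisCohomology
open Summit.BirchSwinnertonDyer.Rank1Residual.X11b.AcSelmer Summit.BirchSwinnertonDyer.Rank1Residual.X11b.Halves
open Summit.BirchSwinnertonDyer.Rank1Residual

namespace Summit.BirchSwinnertonDyer.Rank1Residual.X11b

/-! ### §1 Torsion of `X^∅_ac` at an erratum field, any degree-one slot `v ∋ p` -/

section Torsion

variable (W : WeierstrassCurve ℚ) [W.IsElliptic] [W.IsGloballyMinimal] (p : ℕ) [Fact p.Prime]
  {K : Type} [Field K] [NumberField K]

/-- **`X^∅_ac(E/K_∞)_v` is `Λ`-torsion at an erratum datum, for ANY slot `v ∋ p`**, from JSW17 Thm. 3.3.1 at the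
multiplicative `p` (`thm331_anticyclotomicControl_mult`, first conjunct). Hypotheses: `ErratumHypotheses W p` (`5 ≤ p`,
`p ∥ N`, `E[p]` irreducible), `ord_{s=1} L(E,s) = 1`, a (ram) witness `q ≠ p` (`Mult W q`, `p ∤ ord_q Δ`; gives
`ρ̄_{E,p}` onto by `surj_of_irr_of_ram`, hence `E[p]` irreducible over `G_K`), an erratum field `K` for `q` (`p`
splits: Heegner hypothesis at `p`; `rank_ℤ E(K) = 1` and `Ш(E/K)` finite by GZK over `ℚ`,
`IsErratumField.mordellWeilRank_eq_one_and_shaFinite`), a non-torsion `P ∈ E(K)`, `κ` anticyclotomic with generator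
`γ`, and a prime `v ∋ p` (degree one since `p` splits; THE embedding `embAt K p v` induces it). The conclusion is
stated on the cell's `X11b.AcSelmer.XAc` (definitionally the Literature `Castella2018.AcSelmer.XAc`). CONDITIONAL on
`h331`, `hGZK`, `hnf`. [cite: JetchevSkinnerWan2017, Thm. 3.3.1 with §3.5 (3.5.c) (arXiv:1512.06894 pp. 11, 15)]
[cite: Castella2018Erratum, proof of Thm. 1.1 (p. 4)] -/
theorem P2.RoadFF.isTorsion_XAc_empty_of_thm331_of_isErratumField
    (h331 : thm331_anticyclotomicControl_mult)
    (hGZK : rank_eq_analyticRank_of_analyticRank_le_one) (hnf : exists_isNewformOf)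
    (hE : ErratumHypotheses W p) (hr : W.analyticRank = 1) {q : ℕ} [Fact q.Prime] (hqp : q ≠ p)
    (hmq : Mult W q) (hvq : ¬ p ∣ padicValInt q W.minimalDiscriminantInt) (hK : IsErratumField W K q)
    (P : (W.baseChange K).toAffine.Point) (hP : ¬ IsOfFinAddOrder P)
    (κ : ZpExtension K p) (hκ : κ.IsAnticyclotomic) (γ : Field.absoluteGaloisGroup K)
    [Fact (κ.IsTopGenerator γ)] (v : HeightOneSpectrum (𝓞 K)) (hv : ((p : ℕ) : 𝓞 K) ∈ v.asIdeal) :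
    Module.IsTorsion (IwasawaAlgebra p) (XAc (W.baseChange K) p κ v ∅ γ) := by
  have hp3 : 3 < p := lt_of_lt_of_le (by norm_num) hE.1
  have hmult : Mult W p := hE.2.1
  have hsurj : Surj W p := surj_of_irr_of_ram W p hE.2.2.1 ⟨q, ‹_›, hqp, hmq, hvq⟩
  have hirrK : (W.baseChange K).HasIrreducibleModPGaloisRep p := irrK_of_surj W p hsurj K hK.1.1
  have hsp : SplitsIn K p := hK.splitsIn_of_mult hmult (Ne.symm hqp)
  have hHp : SatisfiesHeegnerHypothesis p K := satisfiesHeegnerHypothesis_of_splitsIn Fact.out hsp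
  obtain ⟨hrank, hSha⟩ := IsErratumField.mordellWeilRank_eq_one_and_shaFinite W hGZK hnf hr hK
  haveI : Finite (W.baseChange K).sha := hSha
  have hShap : Finite (AddCommGroup.primaryComponent (W.baseChange K).sha p) :=
    Finite.of_injective _ Subtype.val_injective
  obtain ⟨he, hf⟩ := degreeOne_of_splitsIn hK.1.1 hsp hv
  exact (h331 W p hp3.le hmult K hK.1 hHp hirrK (embAt K p v hv he hf) v
    (mem_asIdeal_iff_norm_embAt_lt_one v hv he hf) κ hκ γ hrank hShap P hP).1

end Torsion

/-! ### §2 The `Σ`-data from the local fact + Shapiro + control -/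

section SigmaData

variable (W : WeierstrassCurve ℚ) [W.IsElliptic] [W.IsGloballyMinimal] (p : ℕ) [Fact p.Prime]
  {K : Type} [Field K] [NumberField K]

/-- **`Σ`-data at an erratum field, ANY X-slot `v ∋ p`, from the LOCAL fact + Shapiro + control.** Hypotheses as in
`P2.RoadFF.sigmaDataAt_of_prop332_of_noTamagawaDefect_of_isErratumField` (p500562) with the composite binder `h332`
REPLACED by `hloc` (local fact), `h323` (Shapiro) and `h331` (control; needs the datum's non-torsion point `P`);
conclusion `P2.RoadFF.SigmaDataAt W p κ v γ ↑Σ(W,p)(K) (P_Σ)` at the typer's concrete choice terms. The no-defect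
binder is discharged by `P2.RoadFF.splitMult_sigmaPlaces_degreeOne_of_isErratumField` (NoDefect §1) and
`noTamagawaDefect_sigmaPlaces_of_splitMult_imp_degree_one`; the Euler data by `isEulerDataAt_of_mem_sigmaPlacesFinset`;
`P_Σ ≠ 0` by `sigmaEulerElement_ne_zero`. CONDITIONAL on `hloc`, `h323`, `h331`, `hGZK`, `hnf`.
[cite: JetchevSkinnerWan2017, proof of Thm. 6.1.6 (arXiv:1512.06894 tex p0026 L82–96) and Thm. 3.3.1 with §3.5 (3.5.c)]
[cite: SkinnerUrban2014, Prop. 3.2.3 (Shapiro)] [cite: Castella2018, Thm. 2.3 (2.7) and Prop. 2.5 (arXiv:1704.06608 p. 7)] -/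
theorem P2.RoadFF.sigmaDataAt_of_sigmaLocal_of_prop323_of_thm331_of_isErratumField
    (hloc : sigmaLocal_charIdeal_eulerFactor_mem_of_noTamagawaDefect)
    (h323 : SkinnerUrban2014.prop323_XAc_equiv_XBigDecomp) (h331 : thm331_anticyclotomicControl_mult)
    (hGZK : rank_eq_analyticRank_of_analyticRank_le_one) (hnf : exists_isNewformOf)
    (hE : ErratumHypotheses W p) (hr : W.analyticRank = 1) {q : ℕ} [Fact q.Prime] (hqp : q ≠ p)
    (hmq : Mult W q) (hnsq : ¬ W.HasSplitMultiplicativeReductionAtPrime q)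
    (hvq : ¬ p ∣ padicValInt q W.minimalDiscriminantInt) (hK : IsErratumField W K q)
    (P : (W.baseChange K).toAffine.Point) (hP : ¬ IsOfFinAddOrder P)
    (κ : ZpExtension K p) (hκ : κ.IsAnticyclotomic) (γ : Field.absoluteGaloisGroup K)
    [Fact (κ.IsTopGenerator γ)] (v : HeightOneSpectrum (𝓞 K)) (hv : ((p : ℕ) : 𝓞 K) ∈ v.asIdeal) :
    P2.RoadFF.SigmaDataAt W p κ v γ (↑(W.sigmaPlacesFinset p K) : Set (HeightOneSpectrum (𝓞 K)))
      (W.sigmaEulerElement p K κ) := by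
  have hp3 : 3 < p := lt_of_lt_of_le (by norm_num) hE.1
  have hmult : Mult W p := hE.2.1
  have hsp : SplitsIn K p := hK.splitsIn_of_mult hmult (Ne.symm hqp)
  have hHp : SatisfiesHeegnerHypothesis p K := satisfiesHeegnerHypothesis_of_splitsIn Fact.out hsp
  have hT₀ := P2.RoadFF.isTorsion_XAc_empty_of_thm331_of_isErratumField W p h331 hGZK hnf hE hr hqp hmq hvq
    hK P hP κ hκ γ v hv
  have hB := W.noTamagawaDefect_sigmaPlaces_of_splitMult_imp_degree_one p K hK.1 hp3 κ hκ
    (P2.RoadFF.splitMult_sigmaPlaces_degreeOne_of_isErratumField W p hmq hnsq hK)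
  obtain ⟨hT, hCh⟩ := isTorsion_XAc_and_charIdeal_empty_mul_le_of_sigmaLocal_of_prop323 W p hp3.le K hK.1
    hHp v hv κ hκ γ (W.sigmaPlacesFinset p K) (W.forall_mem_sigmaPlacesFinset_not_mem p K) _ _ _
    (W.isEulerDataAt_of_mem_sigmaPlacesFinset p K κ) hB hloc h323 hT₀
  exact ⟨Finset.finite_toSet _, hT, W.sigmaEulerElement_ne_zero p K κ, hCh⟩

/-- **THE `Σ`-STUB OF CRUX 20169's SKELETON WITH THE COMPOSITE BINDER REPLACED**:
`P2.RoadFF.SigmaDataAtErratumDataB W p Σ(·) P_Σ(·)` at every erratum datum and every X-slot `𝔭bar`, from the LOCAL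
fact + Shapiro (K2 item 20430) + control (K2 item 19626) + GZK + modularity — no `prop332_…` (item 20427's composite
binder), no Poitou–Tate. CONDITIONAL on the five named facts; nothing booked.
[cite: JetchevSkinnerWan2017, proof of Thm. 6.1.6 and Thm. 3.3.1 with §3.5 (3.5.c) (arXiv:1512.06894)]
[cite: SkinnerUrban2014, Prop. 3.2.3 (Shapiro)] [cite: Castella2018Erratum, proof of Thm. 1.1 (p. 4)] -/
theorem P2.RoadFF.sigmaDataAtErratumDataB_of_sigmaLocal_of_prop323_of_thm331
    (hloc : sigmaLocal_charIdeal_eulerFactor_mem_of_noTamagawaDefect)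
    (h323 : SkinnerUrban2014.prop323_XAc_equiv_XBigDecomp) (h331 : thm331_anticyclotomicControl_mult)
    (hGZK : rank_eq_analyticRank_of_analyticRank_le_one) (hnf : exists_isNewformOf) :
    P2.RoadFF.SigmaDataAtErratumDataB W p
      (fun K _ _ ↦ (↑(W.sigmaPlacesFinset p K) : Set (HeightOneSpectrum (𝓞 K))))
      (fun K _ _ κ _ ↦ W.sigmaEulerElement p K κ) := by
  intro _ q _ K _ _ Dt H w₀ P hE hr hqp hmq hns hvq hK hCas hP hc hinf κ hκ γ _ ι' e he 𝔭bar h𝔭bar _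
  exact P2.RoadFF.sigmaDataAt_of_sigmaLocal_of_prop323_of_thm331_of_isErratumField W p hloc h323 h331 hGZK hnf
    hE hr hqp hmq hns hvq hK P hinf κ hκ γ 𝔭bar h𝔭bar

/-- **The A-slot twin** (X-slot = the datum's prime `𝔭_{ι'}`), from the same five named facts; nothing booked.
[cite: JetchevSkinnerWan2017, proof of Thm. 6.1.6 and Thm. 3.3.1 (arXiv:1512.06894)] [cite: SkinnerUrban2014, Prop. 3.2.3] -/
theorem P2.RoadFF.sigmaDataAtErratumData_of_sigmaLocal_of_prop323_of_thm331
    (hloc : sigmaLocal_charIdeal_eulerFactor_mem_of_noTamagawaDefect)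
    (h323 : SkinnerUrban2014.prop323_XAc_equiv_XBigDecomp) (h331 : thm331_anticyclotomicControl_mult)
    (hGZK : rank_eq_analyticRank_of_analyticRank_le_one) (hnf : exists_isNewformOf) :
    P2.RoadFF.SigmaDataAtErratumData W p
      (fun K _ _ ↦ (↑(W.sigmaPlacesFinset p K) : Set (HeightOneSpectrum (𝓞 K))))
      (fun K _ _ κ _ ↦ W.sigmaEulerElement p K κ) := by
  intro _ q _ K _ _ Dt H w₀ P hE hr hqp hmq hns hvq hK hCas hP hc hinf κ hκ γ _ ι' e he
  exact P2.RoadFF.sigmaDataAt_of_sigmaLocal_of_prop323_of_thm331_of_isErratumField W p hloc h323 h331 hGZK hnf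
    hE hr hqp hmq hns hvq hK P hinf κ hκ γ _ (natCast_mem_primeOfEmbeddingDatum p ι' w₀.embedding)

end SigmaData

end Summit.BirchSwinnertonDyer.Rank1Residual.X11b

end
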